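import Summits.AnomalousDissipation.AnomalousDissipation.Theorems.CubicParityLoud.Negative.MeanFlow

/-!
# Negative knowledge for the crux `MomentParity.CubicParityLoud` (stmt-AnomalousDissipation-11465), VI:
# the FLUX FLOOR — the cubic moments of a witness carry the energy flux `≈ ε` through every
# wavenumber between the force scale and the Taylor scale

Certified copy of §11 of the cdisprove work file `Cruxes/CubicParityLoud/Disproof.lean`
(refuter-cdisprove-stmt-AnomalousDissipation-11465-g2-0, gen 2, cycle 1). Supports
stmt-AnomalousDissipation-11465; nothing here closes an item (no conclusion asserts a Theses decl).

The LOW-PASS ENERGY ROW. For `K ≤ N` the quadratic observable `p_K(u) = Σ_{e ∈ frame(K)} (u, e)²`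
(Galerkin frame of level `K`; its test fields are level-`N` band tests by `freqBall K ⊆ freqBall N`)
is admissible in the crux, its differential is `2 P_K u`, and its row reads, for every `u ∈ H`,
`⟨F_ν(u), 2P_K u⟩ = 2 ((u, P_K f) − ν‖∇P_K u‖² − Π_K(u))` with the ENERGY FLUX
`Π_K(u) := −∫ (u⊗u) : ∇(P_K u)` (`= ((u·∇)u, P_K u)`, the rate at which the inertial term drains the
modes `|k| ≤ K`; a homogeneous CUBIC functional of `u`, odd under `u ↦ −u`).

(No definitions: `Π_K(u)` is spelled `-Torus.inertialPairing u (Torus.fourierTruncate K u)` and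
`‖∇P_K u‖²` is `(Torus.eGradNormSq (Torus.fourierTruncate K u)).toReal` throughout.)

* `IsWitness.integral_flux_eq` — FLUX IDENTITY: for a witness at level `N` and every `K ≤ N`,
  `Π_K` is `μ`-integrable and `∫ Π_K dμ = ∫ (u, P_K f) dμ − ν ∫ ‖∇P_K u‖² dμ`.
* `IsWitness.flux_floor` — FLUX FLOOR: `ε − ‖f − P_K f‖₂ √E − 4π²K²ν E ≤ ∫ Π_K dμ`
  (energy row `∫(u,f)dμ ≥ ε`, Cauchy–Schwarz on the tail of `f`, Bernstein at level `K`).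

Consequences recorded for constructions (prose; see Disproof.lean §11): "order 3 is free" but ORDER 3
IS NOT ZERO — at every `K` with `‖f − P_K f‖₂√E + 4π²K²νE < ε` the third moments of a witness are
charged with a forward cascade `∫ Π_K dμ > 0`, uniformly over the whole range `K_f ≲ K ≪ ν^{-1/2}`
(the inviscid `4/5`-law skeleton at Galerkin level); in particular for a law `u = m + v` with a
band-limited mean flow `m`, sign-symmetric fluctuations `v` (all odd `v`-moments zero) and stress-carrying
correlations confined below a fixed level `K_*`, one computes `∫ Π_K dμ = 0` for `K ≥ K_*`, so no such
law is a witness once `ν` is small: the designed third cumulant of the blueprint `(m, C, T)` construction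
(equivalently the Carathéodory atoms of the Farkas line) must transport `≈ ε` through EVERY inertial `K`.
-/

noncomputable section

-- `Summit.<Summit>.<Problem>` is the tree's mandated summit-side namespace (CONVENTIONS §2); for this
-- single-conjunct summit the two coincide, so the duplicate is deliberate.
set_option linter.dupNamespace false

namespace Summit.AnomalousDissipation.AnomalousDissipation.Theorems.CubicParityLoud.Negative

open MeasureTheory Filter UnitAddTorus
open scoped InnerProductSpace RealInnerProductSpace ENNReal
open Literature.Analysis.FunctionSpaces Literature.Analysis.FluidPDE
open Summit.AnomalousDissipation.AnomalousDissipation.Theses.MomentParity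

/-! ## §11 FLUX FLOOR -/

section FluxFloor

/-- Band tests of level `K` are band tests of every level `N ≥ K`. -/
theorem IsBandTest.mono {K N : ℕ} (h : K ≤ N) {g : T3 → R3} (hg : IsBandTest K g) : IsBandTest N g := by
  refine ⟨hg.1, hg.2.1, hg.2.2.1, fun k hk => hg.2.2.2 k fun hk' => hk ?_⟩
  exact Finset.mem_erase.2 ⟨(Finset.mem_erase.1 hk').1, Torus.freqBall_mono h (Finset.mem_erase.1 hk').2⟩

/-- The LOW-PASS ENSTROPHY `‖∇P_K u‖²` of `u ∈ H` as a finite Fourier sum: `4π² Σ_{|k| ≤ K} |k|² ‖û(k)‖²`. -/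
theorem lowEnstrophy_eq_sum (K : ℕ) (u : H3) :
    (Torus.eGradNormSq (Torus.fourierTruncate K ((u : L2T3) : T3 → R3))).toReal = 4 * Real.pi ^ 2 * ∑ k ∈ Torus.freqBall K,
      Torus.freqNormSq k * ‖mFourierCoeff (EuclideanSpace.complexify ∘ ((u : L2T3) : T3 → R3)) k‖ ^ 2 := by
  have hint : Integrable ((u : L2T3) : T3 → R3) volume := (Lp.memLp (u : L2T3)).integrable one_le_two
  rw [Torus.fourierTruncate_eq,
    Torus.toReal_eGradNormSq_realTrigPoly Torus.neg_mem_freqBall_of_mem (Torus.isConjSymm_mFourierCoeff hint)]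

/-- The low-pass enstrophy is continuous on `H` (a finite sum of continuous Fourier coefficients). -/
theorem continuous_lowEnstrophy (K : ℕ) :
    Continuous fun u : H3 => (Torus.eGradNormSq (Torus.fourierTruncate K ((u : L2T3) : T3 → R3))).toReal := by
  have h : (fun u : H3 => (Torus.eGradNormSq (Torus.fourierTruncate K ((u : L2T3) : T3 → R3))).toReal) = fun u : H3 => 4 * Real.pi ^ 2 * ∑ k ∈ Torus.freqBall K,
      Torus.freqNormSq k * ‖mFourierCoeff (EuclideanSpace.complexify ∘ ((u : L2T3) : T3 → R3)) k‖ ^ 2 :=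
    funext (lowEnstrophy_eq_sum K)
  rw [h]
  refine continuous_const.mul (continuous_finsetSum _ fun k _ => continuous_const.mul ?_)
  exact ((Torus.continuous_mFourierCoeff_complexify_coe k).comp continuous_subtype_val).norm.pow 2

/-- `0 ≤ ‖∇P_K u‖²`. -/
theorem lowEnstrophy_nonneg (K : ℕ) (u : H3) : 0 ≤ (Torus.eGradNormSq (Torus.fourierTruncate K ((u : L2T3) : T3 → R3))).toReal := ENNReal.toReal_nonneg

/-- **Bernstein at level `K`**: `‖∇P_K u‖² ≤ 4π²K²‖u‖²` for every `u ∈ H`. -/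
theorem lowEnstrophy_le (K : ℕ) (u : H3) : (Torus.eGradNormSq (Torus.fourierTruncate K ((u : L2T3) : T3 → R3))).toReal ≤ 4 * Real.pi ^ 2 * (K : ℝ) ^ 2 * ‖u‖ ^ 2 := by
  have hmem : MemLp ((u : L2T3) : T3 → R3) 2 volume := Lp.memLp (u : L2T3)
  have hint : Integrable ((u : L2T3) : T3 → R3) volume := hmem.integrable one_le_two
  rw [lowEnstrophy_eq_sum]
  have h1 : ∑ k ∈ Torus.freqBall K, Torus.freqNormSq k *
      ‖mFourierCoeff (EuclideanSpace.complexify ∘ ((u : L2T3) : T3 → R3)) k‖ ^ 2 ≤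
      (K : ℝ) ^ 2 * ∑ k ∈ Torus.freqBall K, ‖mFourierCoeff (EuclideanSpace.complexify ∘ ((u : L2T3) : T3 → R3)) k‖ ^ 2 := by
    rw [Finset.mul_sum]
    exact Finset.sum_le_sum fun k hk => mul_le_mul_of_nonneg_right (Torus.mem_freqBall.1 hk) (sq_nonneg _)
  have h2 : ∑ k ∈ Torus.freqBall K, ‖mFourierCoeff (EuclideanSpace.complexify ∘ ((u : L2T3) : T3 → R3)) k‖ ^ 2 ≤
      ‖u‖ ^ 2 := by
    have h := Torus.integral_norm_sq_fourierTruncate_le hmem K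
    rw [Torus.integral_norm_sq_fourierTruncate hint, Torus.integral_norm_sq_coe_eq] at h
    exact h
  calc 4 * Real.pi ^ 2 * ∑ k ∈ Torus.freqBall K, Torus.freqNormSq k *
        ‖mFourierCoeff (EuclideanSpace.complexify ∘ ((u : L2T3) : T3 → R3)) k‖ ^ 2
      ≤ 4 * Real.pi ^ 2 * ((K : ℝ) ^ 2 * ‖u‖ ^ 2) := by
        refine mul_le_mul_of_nonneg_left (h1.trans ?_) (by positivity)
        exact mul_le_mul_of_nonneg_left h2 (sq_nonneg _)
    _ = 4 * Real.pi ^ 2 * (K : ℝ) ^ 2 * ‖u‖ ^ 2 := by ring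

/-- The force term of the low-pass energy row is the pairing with the truncated force:
`∫ ⟪f, P_K u⟫ = (u, P_K f)`. -/
theorem integral_inner_fourierTruncate_coe {f : T3 → R3} (hf : MemLp f 2 volume) (K : ℕ) (u : H3) :
    (∫ x, ⟪f x, Torus.fourierTruncate K ((u : L2T3) : T3 → R3) x⟫_ℝ) =
      Torus.pairing u.1 (Torus.fourierTruncate K f) := by
  have hmem : MemLp ((u : L2T3) : T3 → R3) 2 volume := Lp.memLp (u : L2T3)
  have hint : Integrable ((u : L2T3) : T3 → R3) volume := hmem.integrable one_le_two
  have hfint : Integrable f volume := hf.integrable one_le_two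
  calc (∫ x, ⟪f x, Torus.fourierTruncate K ((u : L2T3) : T3 → R3) x⟫_ℝ)
      = ∫ x, ⟪Torus.fourierTruncate K ((u : L2T3) : T3 → R3) x, f x⟫_ℝ :=
        integral_congr_ae (ae_of_all _ fun x => real_inner_comm _ _)
    _ = ∑ k ∈ Torus.freqBall K, (inner ℂ (mFourierCoeff (EuclideanSpace.complexify ∘ ((u : L2T3) : T3 → R3)) k)
          (mFourierCoeff (EuclideanSpace.complexify ∘ f) k)).re :=
        Torus.integral_inner_fourierTruncate_left hint hf K
    _ = ∑ k ∈ Torus.freqBall K, (inner ℂ (mFourierCoeff (EuclideanSpace.complexify ∘ f) k)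
          (mFourierCoeff (EuclideanSpace.complexify ∘ ((u : L2T3) : T3 → R3)) k)).re :=
        Finset.sum_congr rfl fun k _ => by rw [← inner_conj_symm, Complex.conj_re]
    _ = ∫ x, ⟪Torus.fourierTruncate K f x, ((u : L2T3) : T3 → R3) x⟫_ℝ :=
        (Torus.integral_inner_fourierTruncate_left hfint hmem K).symm
    _ = Torus.pairing u.1 (Torus.fourierTruncate K f) := by
        rw [Torus.pairing]
        exact integral_congr_ae (ae_of_all _ fun x => real_inner_comm _ _)

/-- **The low-pass energy row, pointwise**: for every `u ∈ H`,
`⟨F_ν(u), ∇p_K(u)⟩ = 2 ((u, P_K f) − ν‖∇P_K u‖² − Π_K(u))` with the ENERGY FLUX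
`Π_K(u) := −∫ (u⊗u) : ∇(P_K u)` (`= ((u·∇)u, P_K u)` for smooth `u`; cubic in `u`). -/
theorem nsGeneratorPairing_energy_eq_flux (ν : ℝ) {f : T3 → R3} (hf : MemLp f 2 volume) (K : ℕ) (u : H3) :
    Torus.nsGeneratorPairing ν f u (polyGrad (frameG K) (energyPoly _) u) =
      2 * (Torus.pairing u.1 (Torus.fourierTruncate K f) - ν * (Torus.eGradNormSq (Torus.fourierTruncate K ((u : L2T3) : T3 → R3))).toReal -
        (-Torus.inertialPairing (u : L2T3) (Torus.fourierTruncate K ((u : L2T3) : T3 → R3)))) := by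
  rw [nsGeneratorPairing_energy, integral_inner_fourierTruncate_coe hf]
  ring

/-- **FLUX IDENTITY.** For a witness at level `N` and any `K ≤ N`: the flux `Π_K` is `μ`-integrable
and `∫ Π_K dμ = ∫ (u, P_K f) dμ − ν ∫ ‖∇P_K u‖² dμ` (the low-pass energy row, integrated). -/
theorem IsWitness.integral_flux_eq {f : T3 → R3} (hf : MemLp f 2 volume) {ν : ℝ} {N : ℕ} {E ε : ℝ}
    {μ : Measure H3} (hW : IsWitness f ν N E ε μ) {K : ℕ} (hK : K ≤ N) :
    Integrable (fun u : H3 => (-Torus.inertialPairing (u : L2T3) (Torus.fourierTruncate K ((u : L2T3) : T3 → R3)))) μ ∧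
      ∫ u, (-Torus.inertialPairing (u : L2T3) (Torus.fourierTruncate K ((u : L2T3) : T3 → R3))) ∂μ =
        (∫ u, Torus.pairing u.1 (Torus.fourierTruncate K f) ∂μ) -
          ν * ∫ u, (Torus.eGradNormSq (Torus.fourierTruncate K ((u : L2T3) : T3 → R3))).toReal ∂μ := by
  obtain ⟨hP, -, h3, hstat, -, -⟩ := hW
  have h1 : Integrable (fun u : H3 => ‖u‖) μ := by
    simpa using integrable_norm_pow_of_cube h3 (p := 1) (by norm_num)
  have h2 : Integrable (fun u : H3 => ‖u‖ ^ 2) μ := integrable_norm_pow_of_cube h3 (p := 2) (by norm_num)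
  obtain ⟨hI, h0⟩ := hstat _ (frameG K) (energyPoly _) (fun i => (isBandTest_frameG K i).mono hK)
    (totalDegree_energyPoly _)
  set G : H3 → ℝ := fun u => Torus.nsGeneratorPairing ν f u (polyGrad (frameG K) (energyPoly _) u) with hG
  set A : H3 → ℝ := fun u => Torus.pairing u.1 (Torus.fourierTruncate K f) with hA
  set L : H3 → ℝ := fun u => (Torus.eGradNormSq (Torus.fourierTruncate K ((u : L2T3) : T3 → R3))).toReal with hL
  set Φ : H3 → ℝ := fun u => (-Torus.inertialPairing (u : L2T3) (Torus.fourierTruncate K ((u : L2T3) : T3 → R3))) with hΦ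
  have hGeq : ∀ u, G u = 2 * (A u - ν * L u - Φ u) := fun u =>
    nsGeneratorPairing_energy_eq_flux ν hf K u
  have hAint : Integrable A μ := integrable_pairing (Torus.memLp_fourierTruncate K f 2) h1
  have hLint : Integrable L μ := by
    refine Integrable.mono' (h2.const_mul (4 * Real.pi ^ 2 * (K : ℝ) ^ 2))
      (continuous_lowEnstrophy K).aestronglyMeasurable (ae_of_all _ fun u => ?_)
    rw [Real.norm_eq_abs, abs_of_nonneg (lowEnstrophy_nonneg K u)]
    exact lowEnstrophy_le K u
  have hFeq : ∀ u, Φ u = (A u - ν * L u) - 2⁻¹ * G u := by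
    intro u; rw [hGeq u]; ring
  have hI1 : Integrable (fun u => A u - ν * L u) μ := hAint.sub (hLint.const_mul ν)
  have hI2 : Integrable (fun u => 2⁻¹ * G u) μ := hI.const_mul _
  have hFint : Integrable Φ μ :=
    (hI1.sub hI2).congr (ae_of_all _ fun u => (hFeq u).symm)
  refine ⟨hFint, ?_⟩
  rw [integral_congr_ae (ae_of_all μ hFeq), integral_sub hI1 hI2, integral_sub hAint (hLint.const_mul ν),
    integral_const_mul, integral_const_mul, h0, mul_zero, sub_zero]

/-- The pairing is additive in the field (both pairings honest for continuous fields). -/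
theorem pairing_sub_field (u : H3) {a b : T3 → R3} (ha : Continuous a) (hb : Continuous b) :
    Torus.pairing u.1 (a - b) = Torus.pairing u.1 a - Torus.pairing u.1 b := by
  have hint : Integrable ((u : L2T3) : T3 → R3) volume := (Lp.memLp (u : L2T3)).integrable one_le_two
  have hia : Integrable (fun x => ⟪((u : L2T3) : T3 → R3) x, a x⟫_ℝ) volume :=
    Torus.integrable_inner_of_continuous hint ha
  have hib : Integrable (fun x => ⟪((u : L2T3) : T3 → R3) x, b x⟫_ℝ) volume :=
    Torus.integrable_inner_of_continuous hint hb
  rw [Torus.pairing, Torus.pairing, Torus.pairing, ← integral_sub hia hib]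
  refine integral_congr_ae (ae_of_all _ fun x => ?_)
  change ⟪_, a x - b x⟫_ℝ = _
  rw [inner_sub_right]

/-- **FLUX FLOOR.** Every witness of the crux at `(f, ν, N, E, ε)` (`ν ≥ 0`) drives, through every
wavenumber `K ≤ N`, a mean energy flux
`∫ Π_K dμ ≥ ε − ‖f − P_K f‖₂ √E − 4π²K²ν E`.
For `K` beyond the force scale (`‖f − P_K f‖₂√E ≤ ε/3`) and below the Taylor scale (`4π²K²νE ≤ ε/3`)
the cubic moments of the witness carry at least `ε/3`: the third-order statistics are NOT free to vanish. -/
theorem IsWitness.flux_floor {f : T3 → R3} (hfs : Torus.IsSmooth f) {ν : ℝ} (hν : 0 ≤ ν) {N : ℕ} {E ε : ℝ}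
    {μ : Measure H3} (hW : IsWitness f ν N E ε μ) {K : ℕ} (hK : K ≤ N) :
    ε - Real.sqrt (∫ x, ‖f x - Torus.fourierTruncate K f x‖ ^ 2) * Real.sqrt E -
        4 * Real.pi ^ 2 * (K : ℝ) ^ 2 * ν * E ≤
      ∫ u, (-Torus.inertialPairing (u : L2T3) (Torus.fourierTruncate K ((u : L2T3) : T3 → R3))) ∂μ := by
  have hf : MemLp f 2 volume := hfs.memLp 2
  have hP := hW.1
  have h3 := hW.2.2.1
  have hE : Torus.ensembleEnergy μ ≤ E := hW.2.2.2.2.1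
  have h1 : Integrable (fun u : H3 => ‖u‖) μ := by
    simpa using integrable_norm_pow_of_cube h3 (p := 1) (by norm_num)
  have h2 : Integrable (fun u : H3 => ‖u‖ ^ 2) μ := integrable_norm_pow_of_cube h3 (p := 2) (by norm_num)
  obtain ⟨-, hid⟩ := hW.integral_flux_eq hf hK
  have hPf : MemLp (Torus.fourierTruncate K f) 2 volume := Torus.memLp_fourierTruncate K f 2
  have htail : MemLp (f - Torus.fourierTruncate K f) 2 volume := hf.sub hPf
  set T : ℝ := Real.sqrt (∫ x, ‖f x - Torus.fourierTruncate K f x‖ ^ 2) with hT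
  -- (1) the truncated power: `∫ (u, P_K f) ≥ ∫ (u, f) − T ∫‖u‖ ≥ ε − T √E`
  have hsplit : ∀ u : H3, Torus.pairing u.1 (Torus.fourierTruncate K f) =
      Torus.pairing u.1 f - Torus.pairing u.1 (f - Torus.fourierTruncate K f) := by
    intro u
    have := pairing_sub_field u hfs.continuous (hfs.continuous.sub (Torus.continuous_fourierTruncate K f))
    rw [show f - (f - Torus.fourierTruncate K f) = Torus.fourierTruncate K f from sub_sub_cancel _ _] at this
    linarith [this]
  have hpow : ε - T * Real.sqrt E ≤ ∫ u, Torus.pairing u.1 (Torus.fourierTruncate K f) ∂μ := by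
    have hge := hW.integral_pairing_ge hf
    have hTint : Integrable (fun u : H3 => Torus.pairing u.1 (f - Torus.fourierTruncate K f)) μ :=
      integrable_pairing htail h1
    have hbound : ∫ u, Torus.pairing u.1 (f - Torus.fourierTruncate K f) ∂μ ≤ T * Real.sqrt E := by
      calc ∫ u, Torus.pairing u.1 (f - Torus.fourierTruncate K f) ∂μ
          ≤ ∫ u, ‖u‖ * ‖htail.toLp (f - Torus.fourierTruncate K f)‖ ∂μ :=
            integral_mono hTint (h1.mul_const _) fun u =>
              (le_abs_self _).trans (Torus.abs_pairing_coe_le htail u)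
        _ = (∫ u, ‖u‖ ∂μ) * T := by
            rw [integral_mul_const, norm_toLp_eq_sqrt htail]
            rfl
        _ ≤ Real.sqrt E * T := by
            refine mul_le_mul_of_nonneg_right ?_ (Real.sqrt_nonneg _)
            exact ((le_abs_self _).trans (Real.abs_le_sqrt (sq_integral_norm_le h2))).trans
              (Real.sqrt_le_sqrt hE)
        _ = T * Real.sqrt E := mul_comm _ _
    have heq : ∫ u, Torus.pairing u.1 (Torus.fourierTruncate K f) ∂μ =
        (∫ u, Torus.pairing u.1 f ∂μ) - ∫ u, Torus.pairing u.1 (f - Torus.fourierTruncate K f) ∂μ := by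
      rw [← integral_sub (integrable_pairing hf h1) hTint]
      exact integral_congr_ae (ae_of_all _ fun u => hsplit u)
    rw [heq]
    linarith
  -- (2) the low-pass dissipation: `ν ∫ ‖∇P_K u‖² ≤ 4π²K²ν E`
  have hdis : ν * ∫ u, (Torus.eGradNormSq (Torus.fourierTruncate K ((u : L2T3) : T3 → R3))).toReal ∂μ ≤
      4 * Real.pi ^ 2 * (K : ℝ) ^ 2 * ν * E := by
    have hle : ∫ u, (Torus.eGradNormSq (Torus.fourierTruncate K ((u : L2T3) : T3 → R3))).toReal ∂μ ≤
        ∫ u, 4 * Real.pi ^ 2 * (K : ℝ) ^ 2 * ‖u‖ ^ 2 ∂μ := by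
      refine integral_mono_of_nonneg (ae_of_all _ (lowEnstrophy_nonneg K)) (h2.const_mul _)
        (ae_of_all _ (lowEnstrophy_le K))
    rw [integral_const_mul] at hle
    have hE0 : ∫ u, ‖u‖ ^ 2 ∂μ ≤ E := hE
    calc ν * ∫ u, (Torus.eGradNormSq (Torus.fourierTruncate K ((u : L2T3) : T3 → R3))).toReal ∂μ
        ≤ ν * (4 * Real.pi ^ 2 * (K : ℝ) ^ 2 * ∫ u, ‖u‖ ^ 2 ∂μ) :=
          mul_le_mul_of_nonneg_left hle hν
      _ ≤ ν * (4 * Real.pi ^ 2 * (K : ℝ) ^ 2 * E) := by gcongr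
      _ = 4 * Real.pi ^ 2 * (K : ℝ) ^ 2 * ν * E := by ring
  rw [hid]
  linarith

/-- **NO FLUX-FREE WITNESS.** If `‖f − P_K f‖₂ √E + 4π²K²νE < ε` for some `K ≤ N`, every witness
has `∫ Π_K dμ > 0`: its cubic moment functional `Π_K` is charged (so e.g. no law all of whose odd
moments about `0` vanish, and no law whose third moments are those of its symmetrisation, can witness). -/
theorem IsWitness.integral_flux_pos {f : T3 → R3} (hfs : Torus.IsSmooth f) {ν : ℝ} (hν : 0 ≤ ν) {N : ℕ}
    {E ε : ℝ} {μ : Measure H3} (hW : IsWitness f ν N E ε μ) {K : ℕ} (hK : K ≤ N)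
    (hsmall : Real.sqrt (∫ x, ‖f x - Torus.fourierTruncate K f x‖ ^ 2) * Real.sqrt E +
      4 * Real.pi ^ 2 * (K : ℝ) ^ 2 * ν * E < ε) :
    0 < ∫ u, (-Torus.inertialPairing (u : L2T3) (Torus.fourierTruncate K ((u : L2T3) : T3 → R3))) ∂μ := by
  have h := hW.flux_floor hfs hν hK
  linarith

end FluxFloor

end Summit.AnomalousDissipation.AnomalousDissipation.Theorems.CubicParityLoud.Negative

end
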